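import Summits.ResolutionOfSingularities.ResolutionOfSingularities.Theorems.EquisingularLiftEquisingularLiftNatSecCurveLift
import Summits.ResolutionOfSingularities.ResolutionOfSingularities.Theorems.EquisingularLiftEquisingularLiftNatHRoundSecOfLicence
import HarnessLib

/-!
# EL♮(3), WIDTH TABLE W₂ «Σ-SECTION ROUND» (desk R73/R73a/R73d/R74 (iv)), brick (C), the CAP: `TCPlus.hround_sec : HRoundSecSupplier k 3`, HYPOTHESIS-FREE

res-L1-w45b-nose-w1 g6 (WIDTH seat D-0157 DOOR 1; desk RULING R73d owner, R74 (iv) «the hypothesis-free cap in your reserved module»).  The slot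
`HRoundSecSupplier k n` (res-type-027 g23, ✓ `…NatPrefixSupplierDefs` :248–:297) = ✓ `HRoundKeepNSupplier`'s text with (N2) «`Ẽ₁` regular along `Z̃`»
REPLACED by the letter (L2) and (N4) DELETED.  It is inhabited at `n = 3` by composing
* res-L1-w45b-stub-2 g20's slot-parametric port ✓ `TCPlus.hround_sec_of_secCurveLift (k) (hSL : «Σ-licence») : HRoundSecSupplier k 3`
  (…NatHRoundSecOfLicence — ✓ `nodalHostedRoundFact_of_nodalCurveLiftFact` with the licence call re-pointed to the slot `hSL`), with
* this seat's licence ✓ (B) `SecCurve.secCurveLift (k) : «Σ-licence»` (…NatSecCurveLift — ✓ `embeddedLiftFact_holds` on the one-parameter lci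
  `Z̃ ⊆ Ẽ₁` of ✓ (A) `…NatSecCurveCartier`, transport as ✓ P0, regularity of the lift by ✓ (u2) `…NatSectionRoundLiftRegular`).

* ★ `TCPlus.hround_sec (k) [Field k] : HRoundSecSupplier k 3` — consumed by res-L1-w45b-lead-2's RUNG⁹ `nd_leaves_rung_threeP9` as the term
  `(TCPlus.hround_sec k)` for K5⁹'s binder `HROUNDSEC` (✓ p708511 `…NatLetteredPrefixResolution9`).

DEF-FREE; no `sorry`; standard axioms; `--supports stmt-ResolutionOfSingularities-20148 --as helper`, counted 0.  EL♮(3) is NOT proved by this file (it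
supplies ONE binder of one rung); resolution of singularities in positive characteristic is NOT proved anywhere in this tree (dim 3 in print:
Cossart–Piltant 2008/2009); nothing of [Hironaka2017] is asserted.
-/

set_option linter.dupNamespace false -- mandated namespace `Summit.<Summit>.<Problem>` of this single-conjunct summit

noncomputable section

namespace Summit.ResolutionOfSingularities.ResolutionOfSingularities.Cruxes.EquisingularLiftNat.Sections

/-- ★ **HROUND-SEC INHABITED, HYPOTHESIS-FREE: `TCPlus.hround_sec : HRoundSecSupplier k 3`** — the Σ-SECTION hosted round's upstairs package (W₂):
from a `Ch`-stage with model square, a host letter `E₁ ∈ Ls`, a closed curve `Z ⊆ Ē₁` in the tagged component with finitely many non-regular points,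
the letter (L2) at every closed point of `Z`, `DirStepUnobs`, (D1), the «other members» block and the blow-up `υ'` of `𝓘⟨Z⟩`: a new `Ch`-stage with a
model square for `υ'`, every listed letter transported and the exceptional letter born.  = stub-2's port applied to this seat's Σ-licence.
[folklore; pure composition] [OURS · L1 W4.5b · W₂ brick (C); counted 0; EL♮(3) is NOT proved here] -/
theorem TCPlus.hround_sec (k : Type) [Field k] : HRoundSecSupplier k 3 :=
  TCPlus.hround_sec_of_secCurveLift k (SecCurve.secCurveLift k)

end Summit.ResolutionOfSingularities.ResolutionOfSingularities.Cruxes.EquisingularLiftNat.Sections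

end
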